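import Mathlib.Data.ZMod.Basic
import Mathlib.Analysis.SpecialFunctions.Pow.Real
import Literature.InformationTheory.Entropy.MapEntropy
import HarnessLib

/-!
# Arıkan source polarization for binary sources with functional side information (finitary)

The finitary setting of SOURCE POLARIZATION [Arıkan 2010] used by route PneNP/SzkEntropy (crux
`PeaTwoMemBPP`, line `polarize-to-one-bit-leakage`): a BINARY SOURCE WITH FUNCTIONAL SIDE
INFORMATION is a map `g : ZMod 2 → (Fin m → ZMod 2) → β`; the pair `(B, W')` is uniform on
`F₂ × F₂^m`, the source bit is `B` and the side information is `Y = g B W'`.  Equivalently `(B ; Y)`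
is a binary-input channel with UNIFORM input and transition probabilities in `2^{-m} ℕ` (every
binary-input DMC with rational transition probabilities arises this way up to a common
denominator).  `t = 2^s` independent copies live on `Cfg s m = Fin (2^s) → F₂ × F₂^m` (uniform), the
copies' source bits are transformed by Arıkan's polar transform `U = B^t · F^{⊗s}` over `F₂`
(`polarBit`, closed form), and the LEAKAGE PROFILE `leak g s j = H(U_j | U_{<j}, Y^t)` is spelled as
a difference of Shannon entropies of images of the uniform distribution (`mapEntropy`, in bits).

## Contents

* `polarBit`, `Cfg`, `tgt`, `ctx`, `leak`, `condEnt` — the vocabulary (all `mapEntropy`-based, finite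
  sums only; no measure theory).
* NAMED FACTS (statements only, nothing asserted; discharged by `theorem X_holds : X` elsewhere):
  `ChainRule` — conservation `Σ_j H(U_j | U_{<j}, Y^t) = 2^s · H(B | Y)` [Arıkan 2010, eq. before
  Thm 1; Cover–Thomas Thm 2.5.1]; `PolarizeRough` — two-sided rough polarization with a polynomially
  small unpolarized fraction, UNIFORMLY over all such sources [Arıkan 2010 Thm 1 and Prop. 2 with the
  universal polynomial rate of Guruswami–Xia 2015 / Mondelli–Hassani–Urbanke 2016]; `PolarizeFine` —
  the same with the fine two-sided window `(2^{-2^{⌊s/4⌋}}, 1 − 2^{-2^{⌊s/4⌋}})` [Arıkan–Telatar 2009;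
  Korada–Urbanke 2010 Thm 16 / Lemma 17 for the high-entropy end].

## Design choices / deviations from print

* Index order.  `polarBit s j b = Σ_{i : bits(j) ⊆ bits(i)} b_i` is row `j` of `F^{⊗s}`,
  `F = !![1,0;1,1]`, in NATURAL order; Arıkan's `G_N = B_N F^{⊗n}` differs by the bit-reversal
  permutation `B_N` of the COPIES, under which an i.i.d. source is invariant.  One-step recursion in
  this order (split on the top bit of `j`): for `j < 2^s`, `leak g (s+1) j = leak g⁻ s j` and
  `leak g (s+1) (2^s + j) = leak g⁺ s j` with `g⁻ u (b₂,w₁,w₂) = (g (u+b₂) w₁, g b₂ w₂)` and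
  `g⁺ d (b₁,w₁,w₂) = (b₁ + d, g b₁ w₁, g d w₂)` (both again uniform-bit sources of this shape).
* Uniform input only.  Print [Arıkan 2010] allows an arbitrary joint law of `(X, Y)`; the route only
  needs `X` uniform and independent of the randomness of `Y` (then `(X;Y)` is a genuine channel, the
  Bhattacharyya recursion `Z⁺ = Z²` is exact, and the non-symmetric case reduces to the symmetric one
  by `W_s(y,a|x) = ½ W(y|x ⊕ a)`, which leaves the `H`- and `Z`-processes unchanged).
  TODO(general form): arbitrary finite joint distributions of `(X, Y)` with `X` binary.
* Rates.  `PolarizeRough`/`PolarizeFine` package print's asymptotic statements with the printed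
  polynomial rates as ONE pair of absolute constants `(μ, C)`; small `s` are absorbed by `C`.
* Not here: channel coding, successive-cancellation decoding, error exponents, non-binary alphabets.

## References

* E. Arıkan, *Source polarization*, ISIT 2010, §II–III, Thm 1, Prop. 2.  bib `Arikan2010`.
* E. Arıkan, *Channel polarization…*, IEEE Trans. IT 55 (2009), §VII (`G_N = B_N F^{⊗n}`), Prop. 5.
  bib `Arikan2009`.
* E. Arıkan, E. Telatar, *On the rate of channel polarization*, ISIT 2009.  bib `ArikanTelatar2009`.
* S. B. Korada, R. Urbanke, *Polar codes are optimal for lossy source coding*, IEEE Trans. IT 56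
  (2010), Thm 16, Lemma 17.  bib `KoradaUrbanke2010`.
* V. Guruswami, P. Xia, *Polar codes: speed of polarization and polynomial gap to capacity*, IEEE
  Trans. IT 61 (2015).  bib `GuruswamiXia2015`.
* M. Mondelli, S. H. Hassani, R. Urbanke, *Unified scaling of polar codes*, IEEE Trans. IT 62 (2016),
  Lemmas 5–6, Thm 7.  bib `MondelliHassaniUrbanke2016`.
* T. Cover, J. Thomas, *Elements of Information Theory*, 2nd ed., Thm 2.5.1.  bib `CoverThomas2006`.
-/

noncomputable section

namespace Literature.InformationTheory.Coding.Polar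

open Finset Literature.InformationTheory.Entropy

/-- Row `j` of the polar transform `u = b · F^{⊗s}` over `F₂`, `F = !![1,0;1,1]`, in closed form:
`u_j = Σ_{i : bits(j) ⊆ bits(i)} b_i` (`(F^{⊗s})_{ij} = [i AND j = j]`; e.g. `s = 1`: `u₀ = b₀ + b₁`,
`u₁ = b₁`).  Natural index order (Arıkan's `G_N = B_N F^{⊗n}` differs by the bit-reversal of the
copies, see the module docstring). [cite: Arikan2009, §VII (G_N = B_N F^{⊗n})] -/
def polarBit (s : ℕ) (j : Fin (2 ^ s)) (b : Fin (2 ^ s) → ZMod 2) : ZMod 2 :=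
  ∑ i : Fin (2 ^ s), if i.val &&& j.val = j.val then b i else 0

/-- Sample space of `t = 2^s` independent copies of `(B, W') ∈ F₂ × F₂^m` (uniform): copy `c` is
`X c = (B^{(c)}, W'^{(c)})`. [cite: Arikan2010, §II (i.i.d. copies of the source)] -/
abbrev Cfg (s m : ℕ) : Type := Fin (2 ^ s) → ZMod 2 × (Fin m → ZMod 2)

variable {m : ℕ} {β : Type} [DecidableEq β]

/-- The `j`-th polarized bit `U_j = polarBit s j (B^{(1)}, …, B^{(t)})` of the copies' source bits.
[cite: Arikan2010, §II (U^N = X^N G_N)] -/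
def tgt (s : ℕ) (j : Fin (2 ^ s)) (X : Cfg s m) : ZMod 2 :=
  polarBit s j fun c => (X c).1

/-- The conditioning data of index `j`: the EARLIER polarized bits `U_{<j}` (as a masked vector:
entries `j' ≥ j` are zeroed, so the type does not depend on `j`) and the side information of all
copies `(g B^{(c)} W'^{(c)})_c`. [cite: Arikan2010, §II (the pair (U^{i-1}, Y^N))] -/
def ctx (g : ZMod 2 → (Fin m → ZMod 2) → β) (s : ℕ) (j : Fin (2 ^ s)) (X : Cfg s m) :
    (Fin (2 ^ s) → ZMod 2) × (Fin (2 ^ s) → β) :=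
  (fun j' => if j' < j then polarBit s j' (fun c => (X c).1) else 0, fun c => g (X c).1 (X c).2)

/-- The LEAKAGE PROFILE of the source `g` at block length `2^s`: `leak g s j = H(U_j | U_{<j}, Y^t)`,
spelled as a difference of Shannon entropies (bits) of images of the uniform distribution on
`Cfg s m`: `H((U_j, U_{<j}, Y^t)) − H((U_{<j}, Y^t))`.  Lies in `[0, 1]`.
[cite: Arikan2010, §III (H(U_i | U^{i-1}, Y^N))] -/
def leak (g : ZMod 2 → (Fin m → ZMod 2) → β) (s : ℕ) (j : Fin (2 ^ s)) : ℝ :=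
  mapEntropy univ (fun X : Cfg s m => (tgt s j X, ctx g s j X)) - mapEntropy univ (ctx g s j)

/-- The conditional entropy `H(B | Y)` of the source bit given the side information `Y = g B W'`,
as `H((B, Y)) − H(Y)` over the uniform `(B, W')`.
[cite: CoverThomas2006, Thm 2.2.1 (H(X,Y) = H(Y) + H(X|Y))] -/
def condEnt (g : ZMod 2 → (Fin m → ZMod 2) → β) : ℝ :=
  mapEntropy univ (fun p : ZMod 2 × (Fin m → ZMod 2) => (p.1, g p.1 p.2)) -
    mapEntropy univ (fun p : ZMod 2 × (Fin m → ZMod 2) => g p.1 p.2)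

/-- NAMED FACT — **conservation law of polarization (chain rule)**: for every binary source with
functional side information `g` and every `s`, `Σ_{j < 2^s} H(U_j | U_{<j}, Y^t) = 2^s · H(B | Y)`.
Why true: the `j`-th summand is `H((U_{≤j}, Y^t)) − H((U_{<j}, Y^t))` up to injective recodings of
the outputs, so the sum telescopes to `H((U, Y^t)) − H(Y^t)`; `b ↦ b·F^{⊗s}` is a bijection of `F₂^t`,
so `H((U, Y^t)) = H((B^t, Y^t))`; entropies of independent tuples add.  Printed as
`H(U^N | Y^N) = N·H(X|Y)`. [cite: Arikan2010, §III eq. before Thm 1 (H(U^N|Y^N) = N H(X|Y))] -/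
def ChainRule : Prop :=
  ∀ (m : ℕ) (β : Type) [DecidableEq β] (g : ZMod 2 → (Fin m → ZMod 2) → β) (s : ℕ),
    ∑ j : Fin (2 ^ s), leak g s j = (2 : ℝ) ^ s * condEnt g

/-- NAMED FACT — **two-sided ROUGH polarization with a polynomially small unpolarized fraction,
uniformly over all binary sources with functional side information**: there are absolute `μ > 0` and
`C` such that for every source `g` and every block length `t = 2^s`, at most `C · t^{1−μ}` indices
`j` have `H(U_j | U_{<j}, Y^t) ∈ (t^{-μ}, 1 − t^{-μ})`.  Print: source polarization [Arıkan 2010,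
Thm 1: the fraction of indices with `H(U_i|U^{i-1},Y^N) ∈ (δ, 1−δ)` vanishes] with the universal
polynomial rate of rough polarization (Guruswami–Xia 2015, rough polarization; Mondelli–Hassani–Urbanke
2016, Lemmas 5–6: `E[(Z_n(1−Z_n))^α] ≤ c·2^{-nρ}` from the one-step range `Z⁺ = Z²`,
`Z√(2−Z²) ≤ Z⁻ ≤ 2Z − Z²` alone) and `Z² ≤ H ≤ log₂(1+Z)` [Arıkan 2010, Prop. 2]; a non-symmetric
`(B;Y)` (uniform `B`) is symmetrised by `W_s(y,a|x) = ½W(y|x⊕a)`, which has the same `H`- and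
`Z`-processes.  One `μ` serves for window and count w.l.o.g.; small `s` are absorbed by `C`.
TODO(general form): the printed statements are for arbitrary B-DMCs / binary sources `(X,Y)`.
[cite: Arikan2010, Thm 1 and Prop. 2] -/
def PolarizeRough : Prop :=
  ∃ μ : ℝ, 0 < μ ∧ ∃ C : ℝ, ∀ (m : ℕ) (β : Type) [DecidableEq β]
    (g : ZMod 2 → (Fin m → ZMod 2) → β) (s : ℕ),
    ((univ.filter fun j : Fin (2 ^ s) =>
        (2 : ℝ) ^ (-(μ * s)) < leak g s j ∧ leak g s j < 1 - (2 : ℝ) ^ (-(μ * s))).card : ℝ)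
      ≤ C * (2 : ℝ) ^ ((1 - μ) * s)

/-- The FINE polarization threshold at block length `2^s`: `2^{-2^{⌊s/4⌋}}` (i.e. `2^{-t^β}` with
`β ≈ 1/4 < 1/2`, in pure `ℕ` arithmetic).
[cite: ArikanTelatar2009, Thm 1 (threshold 2^{-N^β}, β < 1/2)] -/
def fineEps (s : ℕ) : ℝ := ((2 : ℝ) ^ (2 ^ (s / 4)))⁻¹

/-- NAMED FACT — **two-sided FINE polarization with a polynomially small unpolarized fraction**:
absolute `μ > 0`, `C` such that for every source `g` and `t = 2^s` at most `C·t^{1−μ}` indices have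
`H(U_j | U_{<j}, Y^t) ∈ (2^{-2^{⌊s/4⌋}}, 1 − 2^{-2^{⌊s/4⌋}})`.  Print: LOW side — rate of polarization
`Z_n ≤ 2^{-2^{nβ}}` for every `β < 1/2` and every B-DMC [Arıkan–Telatar 2009] with polynomially small
deficit [Guruswami–Xia 2015, Thm 1; Mondelli–Hassani–Urbanke 2016, Thm 7]; HIGH side — the mirror
process `S_n = 1 − Z_n²` satisfies `S ≤ S²` resp. `≤ 2S` on the two branches because
`Z(W⁻) ≥ Z√(2−Z²)` for binary-input channels with uniform input [Korada–Urbanke 2010, Lemma 17],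
whence `Pr(Z_n ≥ 1 − 2^{-2^{nβ}}) → 1 − I(W)` [Korada–Urbanke 2010, Thm 16], the Guruswami–Xia
bootstrapping giving the polynomial deficit verbatim for `S_n`; `Z² ≤ H ≤ log₂(1+Z)` converts
thresholds (`β = 1/4` leaves the slack).
TODO(general form): printed for B-DMCs with arbitrary β < 1/2.
[cite: KoradaUrbanke2010, Thm 16 and Lemma 17] -/
def PolarizeFine : Prop :=
  ∃ μ : ℝ, 0 < μ ∧ ∃ C : ℝ, ∀ (m : ℕ) (β : Type) [DecidableEq β]
    (g : ZMod 2 → (Fin m → ZMod 2) → β) (s : ℕ),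
    ((univ.filter fun j : Fin (2 ^ s) =>
        fineEps s < leak g s j ∧ leak g s j < 1 - fineEps s).card : ℝ)
      ≤ C * (2 : ℝ) ^ ((1 - μ) * s)

/-- `0 < fineEps s ≤ 1/2`. [folklore] -/
theorem fineEps_pos_le (s : ℕ) : 0 < fineEps s ∧ fineEps s ≤ 1 / 2 := by
  refine ⟨by unfold fineEps; positivity, ?_⟩
  unfold fineEps
  have h2 : (2 : ℝ) ≤ 2 ^ (2 ^ (s / 4)) := by
    calc (2 : ℝ) = 2 ^ 1 := by norm_num
      _ ≤ 2 ^ (2 ^ (s / 4)) := pow_le_pow_right₀ (by norm_num) Nat.one_le_two_pow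
  have := inv_anti₀ (by norm_num : (0 : ℝ) < 2) h2
  simpa [one_div] using this

end Literature.InformationTheory.Coding.Polar

end
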